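import Mathlib
import Summits.ValiantsHypothesis.ValiantsHypothesis.Theorems.DivisionGapPerMultiplesHardStubSpreadRigidity

/-!
# Relative spread capture (line `uncharged-face-walk` of crux `PerMultiplesHard`, route
DivisionGap; stub `stub_spreadCaptureRel`)

Pure finite combinatorics on permutations of `Fin n`.  Fix a row shift `ζ : Equiv.Perm (Fin n)`,
a row set `S`, a column set `T` and a comparison set `P` of permutations.  A permutation `π` is
COMPATIBLE with the typed rectangle `(S, T)` when
(a) every `i ∈ S` has `π⁻¹ i ∈ T` or `π⁻¹ (ζ i) ∈ T`, and
(b) every `j ∈ T` has `π j ∈ S` or `π j ∈ ζ(S)`.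

Compatibility depends on `π` only through the image `U := π(T)`: (b) says `U ⊆ W := S ∪ ζ(S)`,
(a) says every `i ∈ S` has `i ∈ U` or `ζ i ∈ U`, and `#U = #T` since `π` is injective
(`image_valid_of_compatible`).  Hence the compatible part of `P` is covered by the fibres
`{π ∈ P : π(T) = U}` over the valid `U`, of which there are at most `C(#W, #T) ≤ C(2 #S, #T)`;
if every fibre has at most `M` elements, the compatible part of `P` has at most `C(2 #S, #T) · M`
elements (`card_compatible_le`).  Moreover a compatible `π` exists only if `#S ≤ 2 #T`
(`S ⊆ U ∪ ζ⁻¹(U)`) and `#T ≤ 2 #S` (`U ⊆ W`) (`card_bounds_of_compatible`).  The registered stub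
`stub_spreadCaptureRel` is the conjunction.

-- adapted from Theorems/DivisionGapPerMultiplesHardStubSpreadRigidity.lean (`spreadRigidity_gen`,
steps (1)–(4), with `Finset.univ` replaced by the comparison set `P` and the fibre bound abstracted
to the hypothesis `≤ M`)
-/

noncomputable section

-- the namespace `Summit.ValiantsHypothesis.ValiantsHypothesis.…` is mandated by the crux (registered stub names)
set_option linter.dupNamespace false

namespace Summit.ValiantsHypothesis.ValiantsHypothesis.Theorems.DivisionGap.PerMultiplesHard.SpreadCaptureRel

open scoped BigOperators

/-- **Compatibility is a property of the image.**  If `π` is compatible with `(S, T)` for the shift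
`ζ`, then `U := π(T)` lies in `S ∪ ζ(S)`, has `#U = #T`, and every `i ∈ S` has `i ∈ U` or
`ζ i ∈ U`. [folklore] -/
theorem image_valid_of_compatible {n : ℕ} (ζ : Equiv.Perm (Fin n)) (S T : Finset (Fin n))
    (π : Equiv.Perm (Fin n))
    (ha : ∀ i ∈ S, π.symm i ∈ T ∨ π.symm (ζ i) ∈ T)
    (hb : ∀ j ∈ T, π j ∈ S ∨ ∃ i ∈ S, ζ i = π j) :
    T.image ⇑π ⊆ S ∪ S.image ⇑ζ ∧ (T.image ⇑π).card = T.card ∧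
      ∀ i ∈ S, i ∈ T.image ⇑π ∨ ζ i ∈ T.image ⇑π := by
  refine ⟨?_, Finset.card_image_of_injective _ π.injective, ?_⟩
  · intro x hx
    rw [Finset.mem_image] at hx
    obtain ⟨j, hj, rfl⟩ := hx
    rcases hb j hj with h | ⟨i, hi, h⟩
    · exact Finset.mem_union_left _ h
    · exact Finset.mem_union_right _ (Finset.mem_image.mpr ⟨i, hi, h⟩)
  · intro i hi
    rcases ha i hi with h | h
    · exact Or.inl (Finset.mem_image.mpr ⟨π.symm i, h, π.apply_symm_apply i⟩)
    · exact Or.inr (Finset.mem_image.mpr ⟨_, h, π.apply_symm_apply _⟩)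

/-- **Size constraints from one compatible permutation.**  If some `π` is compatible with `(S, T)`
for the shift `ζ`, then `#S ≤ 2 #T` (the set `S` is covered by `U ∪ ζ⁻¹(U)` for `U := π(T)`,
`#U = #T`) and `#T ≤ 2 #S` (`U ⊆ S ∪ ζ(S)`). [folklore] -/
theorem card_bounds_of_compatible {n : ℕ} (ζ : Equiv.Perm (Fin n)) (S T : Finset (Fin n))
    (π : Equiv.Perm (Fin n))
    (ha : ∀ i ∈ S, π.symm i ∈ T ∨ π.symm (ζ i) ∈ T)
    (hb : ∀ j ∈ T, π j ∈ S ∨ ∃ i ∈ S, ζ i = π j) :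
    S.card ≤ 2 * T.card ∧ T.card ≤ 2 * S.card := by
  obtain ⟨hUW, hUcard, hcov⟩ := image_valid_of_compatible ζ S T π ha hb
  set U : Finset (Fin n) := T.image ⇑π with hU
  constructor
  · have hSsub : S ⊆ U ∪ U.image ⇑ζ.symm := by
      intro i hi
      rcases hcov i hi with h | h
      · exact Finset.mem_union_left _ h
      · exact Finset.mem_union_right _
          (Finset.mem_image.mpr ⟨ζ i, h, ζ.symm_apply_apply i⟩)
    calc S.card ≤ (U ∪ U.image ⇑ζ.symm).card := Finset.card_le_card hSsub
      _ ≤ U.card + (U.image ⇑ζ.symm).card := Finset.card_union_le _ _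
      _ ≤ U.card + U.card := Nat.add_le_add_left Finset.card_image_le _
      _ = 2 * T.card := by rw [hUcard]; ring
  · calc T.card = U.card := hUcard.symm
      _ ≤ (S ∪ S.image ⇑ζ).card := Finset.card_le_card hUW
      _ ≤ S.card + (S.image ⇑ζ).card := Finset.card_union_le _ _
      _ ≤ S.card + S.card := Nat.add_le_add_left Finset.card_image_le _
      _ = 2 * S.card := by ring

/-- **Relative capture count.**  Fix `ζ`, `S`, `T` and a comparison set `P`.  If every fibre
`{π ∈ P : π(T) = U}` over a `U ⊆ S ∪ ζ(S)` with `#U = #T` has at most `M` elements, then the part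
of `P` compatible with `(S, T)` has at most `C(2 #S, #T) · M` elements: it is covered by the fibres
over the valid images, and there are at most `C(#(S ∪ ζ(S)), #T) ≤ C(2 #S, #T)` of those.
[folklore] -/
theorem card_compatible_le {n : ℕ} (ζ : Equiv.Perm (Fin n)) (S T : Finset (Fin n))
    (P : Finset (Equiv.Perm (Fin n))) (M : ℕ)
    (hM : ∀ U : Finset (Fin n), U ⊆ S ∪ S.image ⇑ζ → U.card = T.card →
      (P.filter fun π : Equiv.Perm (Fin n) => T.image ⇑π = U).card ≤ M) :
    (P.filter fun π : Equiv.Perm (Fin n) =>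
        (∀ i ∈ S, π.symm i ∈ T ∨ π.symm (ζ i) ∈ T) ∧
        (∀ j ∈ T, π j ∈ S ∨ ∃ i ∈ S, ζ i = π j)).card ≤ (2 * S.card).choose T.card * M := by
  -- the pieces of the count
  set u : ℕ := T.card with hu
  set W : Finset (Fin n) := S ∪ S.image ⇑ζ with hW
  set V : Finset (Finset (Fin n)) :=
    (W.powersetCard u).filter fun U => ∀ i ∈ S, i ∈ U ∨ ζ i ∈ U with hV
  set Fib : Finset (Fin n) → Finset (Equiv.Perm (Fin n)) := fun U =>
    P.filter fun π : Equiv.Perm (Fin n) => T.image ⇑π = U with hFib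
  set C : Finset (Equiv.Perm (Fin n)) :=
    P.filter fun π : Equiv.Perm (Fin n) =>
      (∀ i ∈ S, π.symm i ∈ T ∨ π.symm (ζ i) ∈ T) ∧
      (∀ j ∈ T, π j ∈ S ∨ ∃ i ∈ S, ζ i = π j) with hC
  -- (1) compatibility depends only on the image `π(T)`, which must be valid
  have hsub : C ⊆ V.biUnion Fib := by
    intro π hπ
    rw [hC, Finset.mem_filter] at hπ
    obtain ⟨hπP, ha, hb⟩ := hπ
    obtain ⟨hUW, hUcard, hcov⟩ := image_valid_of_compatible ζ S T π ha hb
    rw [Finset.mem_biUnion]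
    refine ⟨T.image ⇑π, ?_, ?_⟩
    · rw [hV, Finset.mem_filter, Finset.mem_powersetCard]
      exact ⟨⟨hUW, hUcard⟩, hcov⟩
    · rw [hFib, Finset.mem_filter]
      exact ⟨hπP, rfl⟩
  -- (2) there are at most `C(2 #S, u)` valid images
  have hWcard : W.card ≤ 2 * S.card := by
    calc W.card ≤ S.card + (S.image ⇑ζ).card := Finset.card_union_le _ _
      _ ≤ S.card + S.card := Nat.add_le_add_left Finset.card_image_le _
      _ = 2 * S.card := by ring
  have hVcard : V.card ≤ (2 * S.card).choose u := by
    calc V.card ≤ (W.powersetCard u).card := Finset.card_filter_le _ _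
      _ = W.card.choose u := Finset.card_powersetCard _ _
      _ ≤ (2 * S.card).choose u := Nat.choose_le_choose u hWcard
  -- (3) each fibre over a valid image has at most `M` elements, so `#C ≤ C(2 #S, u) · M`
  calc C.card ≤ (V.biUnion Fib).card := Finset.card_le_card hsub
    _ ≤ ∑ U ∈ V, (Fib U).card := Finset.card_biUnion_le
    _ ≤ ∑ _U ∈ V, M := by
        refine Finset.sum_le_sum fun U hUV => ?_
        rw [hV, Finset.mem_filter, Finset.mem_powersetCard] at hUV
        exact hM U hUV.1.1 hUV.1.2
    _ = V.card * M := by rw [Finset.sum_const, smul_eq_mul]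
    _ ≤ (2 * S.card).choose u * M := Nat.mul_le_mul_right _ hVcard

/-- **stub_spreadCaptureRel — compatible sets split into few block-diagonal fibres, inside any
`P`** (registered stub; steps (1)–(4) of `SpreadRigidity.spreadRigidity_gen` with `Finset.univ`
replaced by `P`).  Fix `ζ`, `S`, `T` and a comparison set `P`.  Compatibility of `π` with `(S, T)`
depends only on the image `U := π(T)`, which must lie in `W := S ∪ ζ(S)` and have `#U = #T`; so if
every such fibre `{π ∈ P : π(T) = U}` has at most `M` elements, the compatible part of `P` has at
most `C(2·#S, #T) · M` elements (there are at most `C(#W, #T) ≤ C(2#S, #T)` images).  Moreover a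
compatible `π` exists only if `#S ≤ 2·#T` (the `#S` pairs `{i, ζ i}` are all hit by `U`) and
`#T ≤ 2·#S` (`U ⊆ W`). [folklore] -/
theorem stub_spreadCaptureRel :
    ∀ (n : ℕ) (ζ : Equiv.Perm (Fin n)) (S T : Finset (Fin n)) (P : Finset (Equiv.Perm (Fin n)))
      (M : ℕ),
      (∀ U : Finset (Fin n), U ⊆ S ∪ S.image ⇑ζ → U.card = T.card →
        (P.filter fun π : Equiv.Perm (Fin n) => T.image ⇑π = U).card ≤ M) →
      (P.filter fun π => (∀ i ∈ S, π.symm i ∈ T ∨ π.symm (ζ i) ∈ T) ∧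
          (∀ j ∈ T, π j ∈ S ∨ ∃ i ∈ S, ζ i = π j)).card ≤ (2 * S.card).choose T.card * M ∧
      ((P.filter fun π => (∀ i ∈ S, π.symm i ∈ T ∨ π.symm (ζ i) ∈ T) ∧
          (∀ j ∈ T, π j ∈ S ∨ ∃ i ∈ S, ζ i = π j)).Nonempty →
        S.card ≤ 2 * T.card ∧ T.card ≤ 2 * S.card) := by
  intro n ζ S T P M hM
  refine ⟨card_compatible_le ζ S T P M hM, ?_⟩
  rintro ⟨π, hπ⟩
  rw [Finset.mem_filter] at hπ
  exact card_bounds_of_compatible ζ S T π hπ.2.1 hπ.2.2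

end Summit.ValiantsHypothesis.ValiantsHypothesis.Theorems.DivisionGap.PerMultiplesHard.SpreadCaptureRel

end
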